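import Summits.BirchSwinnertonDyer.BirchSwinnertonDyer.Theorems.ThetaPartnerAtTwoSignedKatoUpToAtTwoCuspFactorEvaluation
import HarnessLib

/-!
# Route `ThetaPartnerAtTwo` (TP2), crux K3 `SignedKatoDivisibilityUpToAtTwo` (stmt-BirchSwinnertonDyer-20308 / K3P′ 25631), line
# `colemanrat` v12 — the CHARACTER AT AN EXCEPTIONAL ROOT and the lifting bookkeeping for the cusp-factor generation argument

Width seat `bsd-wall-tp2-p2x-w2` g6 (cell `bsd-wall`). HONEST FRAMING: theorems only (no definition, no named fact, no instance, no
`sorry`); closes no item; K3 / K3P′ are NOT settled and BSD is NOT proved by any of this.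

## Why (memo `Cruxes/SignedKatoDivisibilityUpToAtTwo/W2G6-KATO1312-AT2.md` §2–§3; prequel `…CuspFactorEvaluation`; sequel `…CuspFactorGeneration`)

At a `ℂ₂`-point `z₀` (`‖z₀‖ < 1`) of a height-one prime of `Λ = ℤ₂⟦T⟧` the avatar `U_x = (1+T)^{η·ℓ(x)}` of a `2`-adic unit `x` evaluates to
`g(x) = (1+T)^{ηℓ(x)}(z₀)`, a multiplicative function of `x`. If the root is EXCEPTIONAL for the level `2^e` — `(1+T)^{ηK}(z₀) = 5^K`,
`K = 2^{e−2}` — then `g(x) = x` on `1 + 2^eℤ₂` (prequel §4–§5), so `g(x) = x·θ(x̄)` for a CHARACTER `θ` of `(ℤ/2^e)^×` with values in `ℂ₂`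
(§3, `exists_character_of_exceptional`: lift through `ℤ₂^× ↠ (ℤ/2^e)^×`, Mathlib `MonoidHom.liftOfSurjective`); the cusp element then
evaluates to `c²d²` times the cusp BRACKET of `…CuspFactorSpan` (sequel). This file also carries the bookkeeping: the evaluation of the
four-term cusp element (§1), the surjection `ℤ₂^× ↠ (ℤ/2^e)^×` and odd naturals as `2`-adic units (§2), and the lifting of a class of
`(ℤ/2^e)^×` to a natural number prime to `2Q` (§2, Chinese remainder) — the admissibility guards `(c, 6·2·A) = 1`, `(d, 6·2·N) = 1` of
Kato's zeta elements (`Kato2004.EulerSystemValues.ZetaBody`). Kato (Astérisque 295, §13.12) does the analogous step with `Λ/𝔭 ↪ F̄_λ` and an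
auxiliary character of conductor `A = p^e`.

References: [Kato2004Asterisque] K. Kato, Astérisque 295 (2004), Thm. 12.6 (p. 222), §13.12 (pp. 231–233); [Washington1997] §7.1–7.2.
-/

set_option autoImplicit false
-- the Theorems namespace of this sub repeats the summit name by design (D-0017 nested layout)
set_option linter.dupNamespace false

noncomputable section

open scoped BigOperators

open Literature.NumberTheory.EllipticCurves Literature.NumberTheory.EllipticCurves.CyclotomicZp
  Literature.NumberTheory.EllipticCurves.PadicOneUnits

namespace Summit.BirchSwinnertonDyer.BirchSwinnertonDyer.Theorems.SignedKatoOffTwo.CuspEval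

variable {p : ℕ} [Fact p.Prime]

/-! ## §1 Evaluation of the four-term cusp element -/

/-- Evaluation is additive on `Λ` (all coefficients are bounded). [folklore] -/
theorem tsum_coeff_add {z : ℂ_[p]} (hz : ‖z‖ < 1) (G H : PowerSeries ℤ_[p]) :
    ∑' k, ((algebraMap ℚ_[p] ℂ_[p]).comp (algebraMap ℤ_[p] ℚ_[p])) (PowerSeries.coeff k (G + H)) * z ^ k =
      (∑' k, ((algebraMap ℚ_[p] ℂ_[p]).comp (algebraMap ℤ_[p] ℚ_[p])) (PowerSeries.coeff k G) * z ^ k) +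
        ∑' k, ((algebraMap ℚ_[p] ℂ_[p]).comp (algebraMap ℤ_[p] ℚ_[p])) (PowerSeries.coeff k H) * z ^ k := by
  rw [← (summable_map_coeff_mul_pow _ (norm_algebraMap_coeff_le_one G) hz).tsum_add
    (summable_map_coeff_mul_pow _ (norm_algebraMap_coeff_le_one H) hz)]
  exact tsum_congr fun k ↦ by rw [map_add, map_add, add_mul]

/-- Evaluation is compatible with subtraction on `Λ`. [folklore] -/
theorem tsum_coeff_sub {z : ℂ_[p]} (hz : ‖z‖ < 1) (G H : PowerSeries ℤ_[p]) :
    ∑' k, ((algebraMap ℚ_[p] ℂ_[p]).comp (algebraMap ℤ_[p] ℚ_[p])) (PowerSeries.coeff k (G - H)) * z ^ k =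
      (∑' k, ((algebraMap ℚ_[p] ℂ_[p]).comp (algebraMap ℤ_[p] ℚ_[p])) (PowerSeries.coeff k G) * z ^ k) -
        ∑' k, ((algebraMap ℚ_[p] ℂ_[p]).comp (algebraMap ℤ_[p] ℚ_[p])) (PowerSeries.coeff k H) * z ^ k := by
  rw [← (summable_map_coeff_mul_pow _ (norm_algebraMap_coeff_le_one G) hz).tsum_sub
    (summable_map_coeff_mul_pow _ (norm_algebraMap_coeff_le_one H) hz)]
  exact tsum_congr fun k ↦ by rw [map_sub, map_sub, sub_mul]

/-- Evaluation is multiplicative on `Λ` (tree `tsum_map_coeff_mul_mul_pow`). [folklore] -/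
theorem tsum_coeff_mul {z : ℂ_[p]} (hz : ‖z‖ < 1) (G H : PowerSeries ℤ_[p]) :
    ∑' k, ((algebraMap ℚ_[p] ℂ_[p]).comp (algebraMap ℤ_[p] ℚ_[p])) (PowerSeries.coeff k (G * H)) * z ^ k =
      (∑' k, ((algebraMap ℚ_[p] ℂ_[p]).comp (algebraMap ℤ_[p] ℚ_[p])) (PowerSeries.coeff k G) * z ^ k) *
        ∑' k, ((algebraMap ℚ_[p] ℂ_[p]).comp (algebraMap ℤ_[p] ℚ_[p])) (PowerSeries.coeff k H) * z ^ k :=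
  tsum_map_coeff_mul_mul_pow _ (norm_algebraMap_coeff_le_one G) (norm_algebraMap_coeff_le_one H) hz

/-- Evaluation of a constant. [folklore] -/
theorem tsum_coeff_C (z : ℂ_[p]) (a : ℤ_[p]) :
    ∑' k, ((algebraMap ℚ_[p] ℂ_[p]).comp (algebraMap ℤ_[p] ℚ_[p])) (PowerSeries.coeff k (PowerSeries.C a)) * z ^ k =
      ((algebraMap ℚ_[p] ℂ_[p]).comp (algebraMap ℤ_[p] ℚ_[p])) a :=
  (hasSum_map_coeff_C_mul_pow _ a z).tsum_eq

/-- **Evaluation of the four-term cusp element** `C a₁ − C a₂·X − C a₃·Y + C a₄·X·Y` at a point of the open unit disc: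
`ι a₁ − ι a₂·X(z) − ι a₃·Y(z) + ι a₄·X(z)·Y(z)`. [folklore] -/
theorem tsum_coeff_cuspElement {z : ℂ_[p]} (hz : ‖z‖ < 1) (a₁ a₂ a₃ a₄ : ℤ_[p]) (X Y : PowerSeries ℤ_[p]) :
    ∑' k, ((algebraMap ℚ_[p] ℂ_[p]).comp (algebraMap ℤ_[p] ℚ_[p]))
        (PowerSeries.coeff k (PowerSeries.C a₁ - PowerSeries.C a₂ * X - PowerSeries.C a₃ * Y + PowerSeries.C a₄ * X * Y)) * z ^ k =
      ((algebraMap ℚ_[p] ℂ_[p]).comp (algebraMap ℤ_[p] ℚ_[p])) a₁ -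
        ((algebraMap ℚ_[p] ℂ_[p]).comp (algebraMap ℤ_[p] ℚ_[p])) a₂ *
          (∑' k, ((algebraMap ℚ_[p] ℂ_[p]).comp (algebraMap ℤ_[p] ℚ_[p])) (PowerSeries.coeff k X) * z ^ k) -
        ((algebraMap ℚ_[p] ℂ_[p]).comp (algebraMap ℤ_[p] ℚ_[p])) a₃ *
          (∑' k, ((algebraMap ℚ_[p] ℂ_[p]).comp (algebraMap ℤ_[p] ℚ_[p])) (PowerSeries.coeff k Y) * z ^ k) +
        ((algebraMap ℚ_[p] ℂ_[p]).comp (algebraMap ℤ_[p] ℚ_[p])) a₄ *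
          (∑' k, ((algebraMap ℚ_[p] ℂ_[p]).comp (algebraMap ℤ_[p] ℚ_[p])) (PowerSeries.coeff k X) * z ^ k) *
          (∑' k, ((algebraMap ℚ_[p] ℂ_[p]).comp (algebraMap ℤ_[p] ℚ_[p])) (PowerSeries.coeff k Y) * z ^ k) := by
  rw [tsum_coeff_add hz, tsum_coeff_sub hz, tsum_coeff_sub hz, tsum_coeff_C, tsum_coeff_mul hz, tsum_coeff_C, tsum_coeff_mul hz,
    tsum_coeff_C, tsum_coeff_mul hz, tsum_coeff_mul hz, tsum_coeff_C]

/-! ## §2 Units: `ℤ_p^× ↠ (ℤ/p^e)^×`, odd naturals as units, lifting classes to admissible naturals -/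

/-- **`ℤ_p^× → (ℤ/p^e)^×` is onto** (`e ≥ 1`): lift the residue class, and a lift of a unit is a unit (its reduction is not in `(p)`).
[folklore] -/
theorem unitsMap_toZModPow_surjective {e : ℕ} (he : 1 ≤ e) :
    Function.Surjective (Units.map (PadicInt.toZModPow e : ℤ_[p] →+* ZMod (p ^ e)).toMonoidHom) := by
  intro u
  haveI : NeZero (p ^ e) := ⟨pow_ne_zero _ (Fact.out : p.Prime).ne_zero⟩
  obtain ⟨x, hx⟩ := ZMod.ringHom_surjective (PadicInt.toZModPow e : ℤ_[p] →+* ZMod (p ^ e)) (u : ZMod (p ^ e))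
  have hxu : IsUnit x := by
    by_contra hnu
    have hmem : x ∈ IsLocalRing.maximalIdeal ℤ_[p] := (IsLocalRing.mem_maximalIdeal _).mpr hnu
    rw [PadicInt.maximalIdeal_eq_span_p, Ideal.mem_span_singleton] at hmem
    obtain ⟨y, rfl⟩ := hmem
    -- `p · ȳ` is a unit of `ℤ/p^e`: impossible
    have hunit : IsUnit ((p : ZMod (p ^ e)) * PadicInt.toZModPow e y) := by
      rw [← map_natCast (PadicInt.toZModPow e), ← map_mul, hx]; exact u.isUnit
    have hp : IsUnit (p : ZMod (p ^ e)) := isUnit_of_mul_isUnit_left hunit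
    rw [ZMod.isUnit_iff_coprime] at hp
    have : Nat.Coprime p p := Nat.Coprime.coprime_dvd_right (dvd_pow_self p (by omega)) hp
    exact (Fact.out : p.Prime).ne_one ((Nat.coprime_self p).mp this)
  refine ⟨hxu.unit, Units.ext ?_⟩
  show (PadicInt.toZModPow e : ℤ_[p] →+* ZMod (p ^ e)) (hxu.unit : ℤ_[p]) = (u : ZMod (p ^ e))
  rw [IsUnit.unit_spec, hx]

/-- An odd natural number is a `2`-adic unit (more generally: `p ∤ c ⟹ c ∈ ℤ_p^×`). [folklore] -/
theorem exists_unit_eq_natCast {c : ℕ} (hc : ¬ p ∣ c) : ∃ u : ℤ_[p]ˣ, (u : ℤ_[p]) = c := by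
  have hnorm : ‖((c : ℤ) : ℤ_[p])‖ = 1 := by
    refine le_antisymm (PadicInt.norm_le_one _) (not_lt.mp fun hlt ↦ hc ?_)
    rw [PadicInt.norm_int_lt_one_iff_dvd] at hlt
    exact_mod_cast hlt
  have hu : IsUnit ((c : ℕ) : ℤ_[p]) := by
    rw [PadicInt.isUnit_iff]; exact_mod_cast hnorm
  exact ⟨hu.unit, hu.unit_spec⟩

/-- The class of the unit of an odd natural `c` in `(ℤ/p^e)^×` is the residue of `c`. [folklore] -/
theorem coe_unitsMap_of_coe_eq_natCast {e : ℕ} {c : ℕ} (u : ℤ_[p]ˣ) (hu : (u : ℤ_[p]) = c) :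
    ((Units.map (PadicInt.toZModPow e : ℤ_[p] →+* ZMod (p ^ e)).toMonoidHom u : (ZMod (p ^ e))ˣ) : ZMod (p ^ e)) = c := by
  show (PadicInt.toZModPow e : ℤ_[p] →+* ZMod (p ^ e)) (u : ℤ_[p]) = c
  rw [hu, map_natCast]

/-- **Lifting a class to an admissible natural number.** For `Q` prime to `p` and a unit `ū` of `ℤ/p^e` (`e ≥ 1`) there is a natural
number `c` with residue `ū` modulo `p^e` and `(c, p·Q) = 1` (Chinese remainder: `c ≡ ū (p^e)`, `c ≡ 1 (Q)`) — the admissibility guards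
`(c, 6pA) = 1`, `(d, 6pN) = 1` of Kato's zeta elements at `p = 2`, `A = 2^e`. [cite: Kato2004Asterisque, Ex. 13.3 (p. 225), §13.12 (p. 231)] -/
theorem exists_natCast_eq_coprime {e : ℕ} (he : 1 ≤ e) {Q : ℕ} (hQ : Nat.Coprime p Q) (u : (ZMod (p ^ e))ˣ) :
    ∃ c : ℕ, (c : ZMod (p ^ e)) = (u : ZMod (p ^ e)) ∧ Nat.Coprime c (p * Q) := by
  haveI : NeZero (p ^ e) := ⟨pow_ne_zero _ (Fact.out : p.Prime).ne_zero⟩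
  have hco : Nat.Coprime (p ^ e) Q := Nat.Coprime.pow_left _ hQ
  obtain ⟨c, hc1, hc2⟩ := Nat.chineseRemainder hco (u : ZMod (p ^ e)).val 1
  refine ⟨c, ?_, ?_⟩
  · rw [← ZMod.natCast_zmod_val (u : ZMod (p ^ e))]
    exact (ZMod.natCast_eq_natCast_iff _ _ _).mpr hc1
  · refine Nat.Coprime.mul_right ?_ ?_
    · -- `c ≡ val u (mod p^e)` and `val u` is prime to `p`
      have h1 : Nat.Coprime (u : ZMod (p ^ e)).val (p ^ e) := ZMod.val_coe_unit_coprime u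
      have h2 : Nat.Coprime (u : ZMod (p ^ e)).val p := Nat.Coprime.coprime_dvd_right (dvd_pow_self p (by omega)) h1
      have h3 : c ≡ (u : ZMod (p ^ e)).val [MOD p] := Nat.ModEq.of_dvd (dvd_pow_self p (by omega)) hc1
      rw [Nat.coprime_iff_gcd_eq_one, Nat.ModEq.gcd_eq h3]
      exact h2
    · rw [Nat.coprime_iff_gcd_eq_one, Nat.ModEq.gcd_eq hc2]
      exact Nat.gcd_one_left Q

/-! ## §3 (`p = 2`) The character at an exceptional root -/

/-- **`(1+T)^{ηℓ(x)}(z)` is multiplicative in the unit `x`** (`ℓ` is a homomorphism, `binomialSeries_add`, multiplicativity of evaluation).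
[folklore] -/
theorem tsum_binomialSeries_ell_mul {z : ℂ_[2]} (hz : ‖z‖ < 1) (η : ℤ_[2]) (x y : ℤ_[2]ˣ) :
    ∑' k, ((algebraMap ℚ_[2] ℂ_[2]).comp (algebraMap ℤ_[2] ℚ_[2]))
        (PowerSeries.coeff k (PowerSeries.binomialSeries ℤ_[2] (η * ell 2 (x * y)))) * z ^ k =
      (∑' k, ((algebraMap ℚ_[2] ℂ_[2]).comp (algebraMap ℤ_[2] ℚ_[2]))
        (PowerSeries.coeff k (PowerSeries.binomialSeries ℤ_[2] (η * ell 2 x))) * z ^ k) *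
      ∑' k, ((algebraMap ℚ_[2] ℂ_[2]).comp (algebraMap ℤ_[2] ℚ_[2]))
        (PowerSeries.coeff k (PowerSeries.binomialSeries ℤ_[2] (η * ell 2 y))) * z ^ k := by
  rw [ell_mul, mul_add, tsum_binomialSeries_add hz]

/-- **At an exceptional root, `(1+T)^{ηℓ(x)}(z) = x` on `1 + 2^eℤ₂`** (`e ≥ 2`, `K = 2^{e−2}`): if `(1+T)^{ηK}(z) = 5^K` then for every
`2`-adic unit `x ≡ 1 (mod 2^e)`, `(1+T)^{ηℓ(x)}(z) = x` — since `ℓ(x) = K·a` and `5^{Ka} = x` (prequel §4–§5). [cite: Washington1997, §7.2] -/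
theorem tsum_binomialSeries_ell_eq_of_exceptional {z : ℂ_[2]} (hz : ‖z‖ < 1) (η : ℤ_[2]) {e : ℕ} (he : 2 ≤ e)
    (hE : ∑' k, ((algebraMap ℚ_[2] ℂ_[2]).comp (algebraMap ℤ_[2] ℚ_[2]))
        (PowerSeries.coeff k (PowerSeries.binomialSeries ℤ_[2] (η * (2 ^ (e - 2) : ℕ)))) * z ^ k =
      ((algebraMap ℚ_[2] ℂ_[2]).comp (algebraMap ℤ_[2] ℚ_[2])) (cycPow 2 (2 ^ (e - 2) : ℕ)))
    (x : ℤ_[2]ˣ) (hx : (2 : ℤ_[2]) ^ e ∣ (x : ℤ_[2]) - 1) :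
    ∑' k, ((algebraMap ℚ_[2] ℂ_[2]).comp (algebraMap ℤ_[2] ℚ_[2]))
        (PowerSeries.coeff k (PowerSeries.binomialSeries ℤ_[2] (η * ell 2 x))) * z ^ k =
      ((algebraMap ℚ_[2] ℂ_[2]).comp (algebraMap ℤ_[2] ℚ_[2])) (x : ℤ_[2]) := by
  obtain ⟨a, ha⟩ := pow_dvd_ell_of_pow_dvd_sub_one he x hx
  have hell : ell 2 x = (2 ^ (e - 2) : ℕ) * a := by rw [ha]; push_cast; ring
  have h4 : ‖(x : ℤ_[2]) - 1‖ ≤ ‖(2 : ℤ_[2]) ^ 2‖ := by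
    obtain ⟨b, hb⟩ := hx
    rw [hb, norm_mul, norm_pow, norm_pow]
    refine (mul_le_of_le_one_right (pow_nonneg (norm_nonneg _) _) (PadicInt.norm_le_one b)).trans ?_
    exact pow_le_pow_of_le_one (norm_nonneg _) (PadicInt.norm_le_one _) he
  have hcyc := cycPow_ell_eq_of_norm_sub_one_le x h4
  rw [hell, ← mul_assoc, tsum_binomialSeries_eq_cycPow_of_eq hz η (2 ^ (e - 2)) hE a, ← hell, hcyc]

/-- **The character at an exceptional root.** At `p = 2`, `‖z‖ < 1`, `e ≥ 2`, `K = 2^{e−2}`: if `(1+T)^{ηK}(z) = 5^K` then there is a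
CHARACTER `θ : (ℤ/2^e)^× → ℂ₂` with `(1+T)^{ηℓ(x)}(z) = x · θ(x̄)` for every `2`-adic unit `x` (`x̄` its class modulo `2^e`): the
multiplicative function `x ↦ (1+T)^{ηℓ(x)}(z)/x` is trivial on `1 + 2^eℤ₂ = ker(ℤ₂^× ↠ (ℤ/2^e)^×)`
(`tsum_binomialSeries_ell_eq_of_exceptional`) and descends (Mathlib `MonoidHom.liftOfSurjective`). This is the `θ` of the cusp bracket
`B_{θ,θ}` (`…CuspFactorSpan`) at the exceptional primes. [cite: Kato2004Asterisque, §13.12 (pp. 231–233)] -/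
theorem exists_character_of_exceptional {z : ℂ_[2]} (hz : ‖z‖ < 1) (η : ℤ_[2]) {e : ℕ} (he : 2 ≤ e)
    (hE : ∑' k, ((algebraMap ℚ_[2] ℂ_[2]).comp (algebraMap ℤ_[2] ℚ_[2]))
        (PowerSeries.coeff k (PowerSeries.binomialSeries ℤ_[2] (η * (2 ^ (e - 2) : ℕ)))) * z ^ k =
      ((algebraMap ℚ_[2] ℂ_[2]).comp (algebraMap ℤ_[2] ℚ_[2])) (cycPow 2 (2 ^ (e - 2) : ℕ))) :
    ∃ θ : (ZMod (2 ^ e))ˣ →* ℂ_[2], ∀ x : ℤ_[2]ˣ,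
      ∑' k, ((algebraMap ℚ_[2] ℂ_[2]).comp (algebraMap ℤ_[2] ℚ_[2]))
          (PowerSeries.coeff k (PowerSeries.binomialSeries ℤ_[2] (η * ell 2 x))) * z ^ k =
        ((algebraMap ℚ_[2] ℂ_[2]).comp (algebraMap ℤ_[2] ℚ_[2])) (x : ℤ_[2]) *
          θ (Units.map (PadicInt.toZModPow e : ℤ_[2] →+* ZMod (2 ^ e)).toMonoidHom x) := by
  set ι := (algebraMap ℚ_[2] ℂ_[2]).comp (algebraMap ℤ_[2] ℚ_[2]) with hι
  have hιinj : Function.Injective ι := by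
    rw [hι]; exact (algebraMap ℚ_[2] ℂ_[2]).injective.comp (IsFractionRing.injective ℤ_[2] ℚ_[2])
  have hιu : ∀ x : ℤ_[2]ˣ, ι (x : ℤ_[2]) ≠ 0 := fun x ↦ by
    rw [Ne, map_eq_zero_iff ι hιinj]; exact x.ne_zero
  -- the evaluation `g x = (1+T)^{ηℓ(x)}(z)` as a unit-valued homomorphism divided by `x`
  let gval : ℤ_[2]ˣ → ℂ_[2] := fun x ↦
    ∑' k, ι (PowerSeries.coeff k (PowerSeries.binomialSeries ℤ_[2] (η * ell 2 x))) * z ^ k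
  have hgmul : ∀ x y, gval (x * y) = gval x * gval y := fun x y ↦ tsum_binomialSeries_ell_mul hz η x y
  have hgne : ∀ x, gval x ≠ 0 := fun x ↦ tsum_binomialSeries_ne_zero hz _
  have hg1 : gval 1 = 1 := by
    have h := hgmul 1 1
    rw [mul_one] at h
    have : gval 1 * (gval 1 - 1) = 0 := by rw [mul_sub, mul_one, ← h, sub_self]
    have h2 := (mul_eq_zero.mp this).resolve_left (hgne 1)
    linear_combination h2
  let G : ℤ_[2]ˣ →* ℂ_[2]ˣ :=
    { toFun := fun x ↦ Units.mk0 (gval x / ι (x : ℤ_[2])) (div_ne_zero (hgne x) (hιu x))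
      map_one' := by
        apply Units.ext
        simp only [Units.val_mk0, Units.val_one, hg1, map_one, div_one]
      map_mul' := fun x y ↦ by
        apply Units.ext
        simp only [Units.val_mk0, Units.val_mul, hgmul, Units.val_mul, map_mul]
        field_simp }
  have hG : ∀ x : ℤ_[2]ˣ, ((G x : ℂ_[2]ˣ) : ℂ_[2]) = gval x / ι (x : ℤ_[2]) := fun x ↦ rfl
  -- the projection to `(ℤ/2^e)^×` and its kernel
  set π : ℤ_[2]ˣ →* (ZMod (2 ^ e))ˣ := Units.map (PadicInt.toZModPow e : ℤ_[2] →+* ZMod (2 ^ e)).toMonoidHom with hπ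
  have hπsurj : Function.Surjective π := unitsMap_toZModPow_surjective (p := 2) (by omega)
  have hker : π.ker ≤ G.ker := by
    intro x hx
    rw [MonoidHom.mem_ker] at hx ⊢
    have hx1 : (PadicInt.toZModPow e : ℤ_[2] →+* ZMod (2 ^ e)) ((x : ℤ_[2]) - 1) = 0 := by
      have h := congrArg (fun u : (ZMod (2 ^ e))ˣ ↦ (u : ZMod (2 ^ e))) hx
      have h' : (PadicInt.toZModPow e : ℤ_[2] →+* ZMod (2 ^ e)) (x : ℤ_[2]) = 1 := by
        rw [Units.val_one] at h
        exact h
      rw [map_sub, map_one, h', sub_self]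
    have hdvd : (2 : ℤ_[2]) ^ e ∣ (x : ℤ_[2]) - 1 := by
      have hmem : (x : ℤ_[2]) - 1 ∈ RingHom.ker (PadicInt.toZModPow e : ℤ_[2] →+* ZMod (2 ^ e)) := hx1
      rw [PadicInt.ker_toZModPow, Ideal.mem_span_singleton] at hmem
      exact_mod_cast hmem
    have hval := tsum_binomialSeries_ell_eq_of_exceptional hz η he hE x hdvd
    apply Units.ext
    rw [hG, Units.val_one, div_eq_one_iff_eq (hιu x)]
    exact hval
  let θ' : (ZMod (2 ^ e))ˣ →* ℂ_[2]ˣ := MonoidHom.liftOfSurjective π hπsurj ⟨G, hker⟩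
  have hθ' : ∀ x : ℤ_[2]ˣ, θ' (π x) = G x := fun x ↦ by
    simp only [θ', MonoidHom.liftOfSurjective, MonoidHom.liftOfRightInverse_comp_apply]
  refine ⟨(Units.coeHom ℂ_[2]).comp θ', fun x ↦ ?_⟩
  rw [MonoidHom.comp_apply, Units.coeHom_apply, hθ', hG, mul_div_cancel₀ _ (hιu x)]

end Summit.BirchSwinnertonDyer.BirchSwinnertonDyer.Theorems.SignedKatoOffTwo.CuspEval

end
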